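import Summits.MatrixMultiplication.MatrixMultiplication.Theses.ThinBlockAlpha

/-!
# MatrixMultiplication / ThinBlockAlpha — the assembly `Assembly` (stmt-MatrixMultiplication-11004)

Route `MatrixMultiplication/ThinBlockAlpha`, item stmt-MatrixMultiplication-11004 (`Assembly`, rank 1):

  `ThinPackings → ThinCertifiesOmega → MatrixMultiplication`.

Proof (pure glue, self-contained; it is also, verbatim, the type of the route's kernel-checked
deciding theorem `Summit.MatrixMultiplication.MatrixMultiplication.Theses.ThinBlockAlpha.closes`).
For `0 < t ≤ 1`, `ThinPackings` at shape exponent `a = 1 - t` and slack `η = t` produces a thin STPP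
family `⟨N, M, N⟩`, `N ≥ 2`, `M ≥ N^{1-t}`, `|H| ≤ L·N^{2+t}` in a finite abelian group, and
`ThinCertifiesOmega` turns it into `(2 + (1 - t))·ω(ℂ) ≤ 3(2 + t)`, i.e. `(3 - t)·ω(ℂ) ≤ 6 + 3t`.
With `ω(ℂ) ≤ 3` (`omega_le_three'`, flattening-bound module) this gives `3·ω(ℂ) ≤ 6 + 6t`, i.e.
`ω(ℂ) ≤ 2 + 2t` for every small `t > 0`, hence `ω(ℂ) ≤ 2`; `ω(ℂ) ≥ 2` is `omega_two_le`, and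
`MatrixMultiplication_iff` (`MatrixMultiplication ↔ ω(ℂ) = 2`) closes.

References: H. Cohn, R. Kleinberg, B. Szegedy, C. Umans, *Group-theoretic algorithms for matrix
multiplication*, FOCS 2005 (arXiv:math/0511460), Thm. 5.5; M. Bläser, *Fast Matrix Multiplication*,
Theory of Computing Graduate Surveys 5 (2013), §5.
-/

namespace Summit.MatrixMultiplication.MatrixMultiplication.Theorems

open Summit.MatrixMultiplication.MatrixMultiplication.Theses.ThinBlockAlpha
open Literature.Computability.AlgebraicComplexity

/-- The glue inequality of route ThinBlockAlpha: thin packings (`ThinPackings`) read through the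
square-form certificate (`ThinCertifiesOmega`) at shape exponent `a = 1 - t` and slack `η = t`
give `(3 - t)·ω(ℂ) ≤ 3(2 + t)` for every `0 < t ≤ 1`. [folklore] -/
theorem thinBlockAlpha_sub_mul_omega_le (h₁ : ThinPackings) (h₂ : ThinCertifiesOmega)
    {t : ℝ} (ht0 : 0 < t) (ht1 : t ≤ 1) :
    (3 - t) * omega ℂ ≤ 3 * (2 + t) := by
  obtain ⟨H, i1, i2, L, N, M, A, B, C, hS, hc, hN, hM, hP⟩ :=
    h₁ (1 - t) (by linarith) (by linarith) t ht0
  have h := h₂ (1 - t) (by linarith) (by linarith) t ht0 H L N M A B C hS hc hN hM hP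
  calc (3 - t) * omega ℂ = (2 + (1 - t)) * omega ℂ := by ring
    _ ≤ 3 * (2 + t) := h

/-- From the glue inequality: `ThinPackings` and `ThinCertifiesOmega` give `ω(ℂ) ≤ 2 + ε` for every
`ε > 0` (take `t = min ε 1 / 4` and use `ω(ℂ) ≤ 3`, `omega_le_three'`). [folklore] -/
theorem thinBlockAlpha_omega_le_two_add (h₁ : ThinPackings) (h₂ : ThinCertifiesOmega)
    {ε : ℝ} (hε : 0 < ε) : omega ℂ ≤ 2 + ε := by
  have hle3 : omega ℂ ≤ 3 := omega_le_three' ℂ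
  have hm0 : 0 < min ε 1 := lt_min hε one_pos
  have hmε : min ε 1 ≤ ε := min_le_left ε 1
  have hm1 : min ε 1 ≤ 1 := min_le_right ε 1
  have hk := thinBlockAlpha_sub_mul_omega_le h₁ h₂ (t := min ε 1 / 4) (by positivity) (by linarith)
  nlinarith [mul_nonneg hm0.le (sub_nonneg.mpr hle3)]

/-- **Assembly of route ThinBlockAlpha** (item stmt-MatrixMultiplication-11004):
`ThinPackings → ThinCertifiesOmega → MatrixMultiplication`. Thin abelian STPP packings of one shape
`⟨N, N^{1-t}, N⟩` with slack `N^t`, read through the square form of CKSU 2005 Thm. 5.5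
(`ThinCertifiesOmega`), give `(3 - t)·ω(ℂ) ≤ 6 + 3t`; with `ω(ℂ) ≤ 3` this is `ω(ℂ) ≤ 2 + 2t` for
all small `t > 0`, so `ω(ℂ) ≤ 2`, and `ω(ℂ) ≥ 2` (flattening bound) makes it `ω(ℂ) = 2`, which is
`MatrixMultiplication` (`MatrixMultiplication_iff`). The statement is literally the type of the
route's deciding theorem `Theses.ThinBlockAlpha.closes`; the proof here is self-contained.
[cite: CohnKleinbergSzegedyUmans2005, Thm. 5.5] [cite: Blaser2013, §5] -/
theorem thinBlockAlpha_assembly_proof :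
    Summit.MatrixMultiplication.MatrixMultiplication.Theses.ThinBlockAlpha.Assembly := by
  unfold Summit.MatrixMultiplication.MatrixMultiplication.Theses.ThinBlockAlpha.Assembly
  intro h₁ h₂
  rw [_root_.MatrixMultiplication_iff]
  refine le_antisymm ?_ (omega_two_le ℂ)
  exact le_of_forall_pos_le_add fun ε hε => thinBlockAlpha_omega_le_two_add h₁ h₂ hε

end Summit.MatrixMultiplication.MatrixMultiplication.Theorems
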